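import Summits.HubbardSuperconductivity.HubbardSuperconductivity.Theorems.BcsKacWindowInfraredCompletionNecessity

/-!
# Crux `InfraredCompletion` (stmt-HubbardSuperconductivity-1321, route BcsKacWindow), line `birth`:
# stub A (`stub_softWindowFloor`) from hypothesis W and a volume-monotone heredity of pair weight

Registered sub-goal `stub_softWindowFloor_of_volumeMonotone` of the line (lead c15). Stub A of the
skeleton `Cruxes/InfraredCompletion/Lines/birth.lean` is a SIZE TRANSFER: the coherence-window
hypothesis W of the crux gives `d`-wave pair order `c₀Δ(U)²` for every normalised sector ground state
of `hubbardTorus 2 L 1 U` on even tori with `s₀ ≤ Δ(U)·L ≤ s` (for `U < U₁(s)`, `U₁` uncontrolled),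
while the stub asks for a coarse-grained FLOOR `c_A Δ(U)² L² ≤ Σ_{|q_m|² ≤ (Δ(U)/t)²} S_ψ(m)` on ALL
larger even tori `Δ(U)·L ≥ t`. The tree compares sector ground states of `hubbardTorus` at two
different sides only through ground ENERGIES (block trial states); no declaration transports a
ground-state EXPECTATION floor from one side to a larger one. This file isolates exactly that missing
input and proves that it suffices:

* `stub_softWindowFloor_of_volumeMonotone` — IF (hypothesis `hVM`, an explicit antecedent, never
  asserted; conjecture-grade) for every doping interval `[a,b] ⊂ (0,1/2)` there are `C > 0`, `L₀`,
  `U⋆ > 0` such that for `U ∈ (0,U⋆)`, `δ ∈ [a,b]`, even sides `L₀ ≤ L' ≤ L` and every level `θ`,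
  zero-mode pair weight `θ·L''² ≤ S_{ψ''}(0)` of every normalised sector ground state on every even
  side `L''` of the octave `L' ≤ 2L''`, `L'' ≤ L'` forces `C·θ·L² ≤ Σ_{|q_m|² ≤ (2π/L')²} S_ψ(m)` for
  every normalised sector ground state on side `L` ("Griffiths in volume" for the coarse-grained pair
  weight, error-free and uniform in `U`, `δ`, `θ`, `L'`), THEN the registered signature of stub A holds,
  with `c_A = min(1,C)·c₀`, `s_A = max(s₀, L₀)`, `U_A(t) = min(U₁(2πt+2), U⋆)`.
  Proof: for `Δ(U)·L ≤ 2πt + 2` hypothesis W applies at `L` itself and `S_ψ(0)` lies in the window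
  (`pairStructureFactor_zero_le_softWindowSum`); otherwise an even `L' ∈ [2πt/Δ(U), 2πt/Δ(U) + 2)`
  (`exists_even_side`) satisfies `L' ≤ L`, its octave lies inside W's window
  `[s₀/Δ(U), (2πt+2)/Δ(U)]`, W gives `θ = c₀Δ(U)²` there, `hVM` gives the floor at radius
  `2π/L' ≤ Δ(U)/t`, and the window sum is monotone in the radius (`pairStructureFactor_nonneg`).

No physics is used and nothing here proves `hVM`, stub A or the crux. Kennedy–Lieb–Shastry, PRL 61
(1988) 2582 (Fourier bookkeeping of an order operator); Griffiths, Phys. Rev. 152 (1966) 240 (block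
versus global order). [folklore] No definition is introduced.
-/

noncomputable section

-- the mandated namespace `Summit.<Summit>.<Problem>.Theorems…` repeats `HubbardSuperconductivity`
-- (single-problem summit, D-0017), which the `dupNamespace` linter flags on every declaration
set_option linter.dupNamespace false

namespace Summit.HubbardSuperconductivity.HubbardSuperconductivity.Theorems.InfraredCompletion

open Literature.MathematicalPhysics.QuantumLattice Literature.Probability.LatticeModels
open scoped Matrix

/-- **An even side in every window of length two**: for `x > 0` there is an even natural number
`L'` with `2x ≤ L' < 2x + 2` (namely `L' = 2⌈x⌉`), and `L' > 0`. [folklore] -/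
private theorem exists_even_side (x : ℝ) (hx : 0 < x) :
    ∃ L' : ℕ, 0 < L' ∧ Even L' ∧ 2 * x ≤ (L' : ℝ) ∧ (L' : ℝ) < 2 * x + 2 := by
  refine ⟨2 * ⌈x⌉₊, ?_, even_two_mul _, ?_, ?_⟩
  · have : 0 < ⌈x⌉₊ := Nat.ceil_pos.2 hx
    omega
  · have h := Nat.le_ceil x
    push_cast
    linarith
  · have h := Nat.ceil_lt_add_one hx.le
    push_cast
    linarith

/-- **Stub A from W and an error-free volume monotonicity of coarse-grained pair weight**
(registered sub-goal of line `birth`, crux `InfraredCompletion`). Hypothesis (first antecedent, the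
missing cross-volume input `hVM`, localized to small `U` and `δ ∈ [a,b]`): for every `[a,b] ⊂ (0,1/2)`
there are `C > 0`, `L₀`, `U⋆ > 0` such that for `U ∈ (0,U⋆)`, `δ ∈ [a,b]`, even sides
`L₀ ≤ L' ≤ L` and any `θ`: if every normalised `(2⌊(1-δ)L''²/2⌋, S^z = 0)`-sector ground state of
`hubbardTorus 2 L'' 1 U` on every even side `L''` with `L' ≤ 2L''`, `L'' ≤ L'` has
`θ·L''² ≤ S_{ψ''}(0)`, then every normalised sector ground state on side `L` has
`C·θ·L² ≤ Σ_{m : |q_m|² ≤ (2π/L')²} S_ψ(m)` (`S = pairStructureFactor dWaveFormFactor`). Remaining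
antecedents and conclusion: the signature of `stub_softWindowFloor` verbatim (guards, flat pin,
coherence-window bound W ⇒ soft-window floor on all bulk tori), realised with `c_A = min(1,C)·c₀`,
`s_A = max(s₀, L₀)`, `U_A(t) = min(U₁(2πt+2), U⋆)`: below `Δ(U)·L ≤ 2πt+2` W applies at `L` and the
zero mode lies in the window; above, W feeds `θ = c₀Δ(U)²` on the octave of an even
`L' ∈ [2πt/Δ(U), 2πt/Δ(U)+2)`, `L' ≤ L`, and `hVM` returns the floor at radius `2π/L' ≤ Δ(U)/t`.
Kennedy–Lieb–Shastry, PRL 61 (1988) 2582; Griffiths, Phys. Rev. 152 (1966) 240. [folklore] -/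
theorem stub_softWindowFloor_of_volumeMonotone :
    (∀ (a b : ℝ), 0 < a → a < b → b < 1 / 2 → ∃ C L₀ Ustar : ℝ, 0 < C ∧ 0 < Ustar ∧
      ∀ (U δ θ : ℝ) (L' L : ℕ) [NeZero L'] [NeZero L], 0 < U → U < Ustar → δ ∈ Set.Icc a b →
        Even L' → Even L → L₀ ≤ L' → L' ≤ L →
        (∀ (L'' : ℕ) [NeZero L''], Even L'' → (L' : ℝ) ≤ 2 * L'' → L'' ≤ L' →
          ∀ ψ'' : Fock (Orb (FermionTorus 2 L'')), star ψ'' ⬝ᵥ ψ'' = 1 →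
            IsGroundStateInSector (hubbardTorus 2 L'' 1 U) (2 * ⌊(1 - δ) * (L'' : ℝ) ^ 2 / 2⌋₊) 0 ψ'' →
              θ * (L'' : ℝ) ^ 2 ≤ pairStructureFactor dWaveFormFactor L'' ψ'' 0) →
        ∀ ψ : Fock (Orb (FermionTorus 2 L)), star ψ ⬝ᵥ ψ = 1 →
          IsGroundStateInSector (hubbardTorus 2 L 1 U) (2 * ⌊(1 - δ) * (L : ℝ) ^ 2 / 2⌋₊) 0 ψ →
            C * θ * (L : ℝ) ^ 2 ≤
              ∑ m ∈ Finset.univ.filter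
                  (fun m : Fin 2 → ZMod L => momentumNormSq L m ≤ (2 * Real.pi / (L' : ℝ)) ^ 2),
                pairStructureFactor dWaveFormFactor L ψ m) →
    ∀ (a b κ₁ κ₂ c₀ s₀ : ℝ) (Δ : ℝ → ℝ), 0 < a → a < b → b < 1 / 2 → 0 < κ₁ → κ₁ ≤ κ₂ → 0 < c₀ →
      0 < s₀ → (∀ U : ℝ, 0 < U → Real.exp (-(κ₂ / U ^ 2)) ≤ Δ U ∧ Δ U ≤ Real.exp (-(κ₁ / U ^ 2))) →
      (∀ s : ℝ, s₀ ≤ s → ∃ U₁ : ℝ, 0 < U₁ ∧ ∀ δ ∈ Set.Icc a b, ∀ U ∈ Set.Ioo (0:ℝ) U₁,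
        ∀ (L : ℕ) [NeZero L], Even L → s₀ ≤ Δ U * L → Δ U * L ≤ s →
          ∀ ψ : Fock (Orb (FermionTorus 2 L)), star ψ ⬝ᵥ ψ = 1 →
            IsGroundStateInSector (hubbardTorus 2 L 1 U) (2 * ⌊(1 - δ) * (L : ℝ) ^ 2 / 2⌋₊) 0 ψ →
              c₀ * Δ U ^ 2 ≤ (expect ((pairField dWaveFormFactor L)ᴴ * pairField dWaveFormFactor L)
                ψ).re / (L : ℝ) ^ 4) →
      ∃ cA sA : ℝ, 0 < cA ∧ ∀ t : ℝ, sA ≤ t → ∃ UA : ℝ, 0 < UA ∧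
        ∀ δ ∈ Set.Icc a b, ∀ U ∈ Set.Ioo (0:ℝ) UA, ∀ (L : ℕ) [NeZero L], Even L → t ≤ Δ U * L →
          ∀ ψ : Fock (Orb (FermionTorus 2 L)), star ψ ⬝ᵥ ψ = 1 →
            IsGroundStateInSector (hubbardTorus 2 L 1 U) (2 * ⌊(1 - δ) * (L : ℝ) ^ 2 / 2⌋₊) 0 ψ →
              cA * Δ U ^ 2 * (L : ℝ) ^ 2 ≤
                ∑ m ∈ Finset.univ.filter
                    (fun m : Fin 2 → ZMod L => momentumNormSq L m ≤ (Δ U / t) ^ 2),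
                  pairStructureFactor dWaveFormFactor L ψ m := by
  intro hVM a b κ₁ κ₂ c₀ s₀ Δ ha hab hb hκ₁ hκ₁₂ hc₀ hs₀ hpin hW
  obtain ⟨C, L₀, Ustar, hC, hUstar, hVM⟩ := hVM a b ha hab hb
  refine ⟨min 1 C * c₀, max s₀ L₀, mul_pos (lt_min one_pos hC) hc₀, fun t ht => ?_⟩
  have hts₀ : s₀ ≤ t := le_trans (le_max_left _ _) ht
  have htL₀ : L₀ ≤ t := le_trans (le_max_right _ _) ht
  have ht0 : 0 < t := lt_of_lt_of_le hs₀ hts₀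
  have hπt : 3 * t < Real.pi * t := by nlinarith [Real.pi_gt_three]
  -- the window top fed to W
  have hs : s₀ ≤ 2 * Real.pi * t + 2 := by linarith
  obtain ⟨U₁, hU₁, hWs⟩ := hW (2 * Real.pi * t + 2) hs
  refine ⟨min U₁ Ustar, lt_min hU₁ hUstar, ?_⟩
  intro δ hδ U hU L _ hL htL ψ hψ hGS
  have hU0 : 0 < U := hU.1
  have hUst : U < Ustar := lt_of_lt_of_le hU.2 (min_le_right _ _)
  have hUU₁ : U ∈ Set.Ioo (0:ℝ) U₁ := ⟨hU0, lt_of_lt_of_le hU.2 (min_le_left _ _)⟩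
  have hΔpos : 0 < Δ U := lt_of_lt_of_le (Real.exp_pos _) (hpin U hU0).1
  have hΔne : Δ U ≠ 0 := hΔpos.ne'
  have hΔle : Δ U ≤ 1 := by
    refine le_trans (hpin U hU0).2 (Real.exp_le_one_iff.2 ?_)
    have : 0 ≤ κ₁ / U ^ 2 := by positivity
    linarith
  have hL0 : (0 : ℝ) < (L : ℝ) := Nat.cast_pos.2 (Nat.pos_of_ne_zero (NeZero.ne L))
  have hmin1 : min 1 C ≤ 1 := min_le_left _ _
  have hminC : min 1 C ≤ C := min_le_right _ _
  have hnn : 0 ≤ c₀ * Δ U ^ 2 * (L : ℝ) ^ 2 := by positivity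
  by_cases hcase : Δ U * L ≤ 2 * Real.pi * t + 2
  · -- Case 1: `L` itself lies in W's window
    have hord := hWs δ hδ U hUU₁ L hL (le_trans hts₀ htL) hcase ψ hψ hGS
    have hL2 : (0 : ℝ) < (L : ℝ) ^ 2 := by positivity
    have hL4 : (0 : ℝ) < (L : ℝ) ^ 4 := by positivity
    rw [le_div_iff₀ hL4] at hord
    have hS0 : c₀ * Δ U ^ 2 * (L : ℝ) ^ 2 ≤ pairStructureFactor dWaveFormFactor L ψ 0 := by
      rw [pairStructureFactor_zero dWaveFormFactor L ψ, le_div_iff₀ hL2]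
      calc c₀ * Δ U ^ 2 * (L : ℝ) ^ 2 * (L : ℝ) ^ 2 = c₀ * Δ U ^ 2 * (L : ℝ) ^ 4 := by ring
        _ ≤ _ := hord
    calc min 1 C * c₀ * Δ U ^ 2 * (L : ℝ) ^ 2 = min 1 C * (c₀ * Δ U ^ 2 * (L : ℝ) ^ 2) := by ring
      _ ≤ 1 * (c₀ * Δ U ^ 2 * (L : ℝ) ^ 2) := mul_le_mul_of_nonneg_right hmin1 hnn
      _ = c₀ * Δ U ^ 2 * (L : ℝ) ^ 2 := one_mul _
      _ ≤ pairStructureFactor dWaveFormFactor L ψ 0 := hS0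
      _ ≤ _ := pairStructureFactor_zero_le_softWindowSum ψ (Δ U / t)
  · -- Case 2: `Δ(U)·L > 2πt + 2`; transfer from the even side `L' ∈ [2πt/Δ, 2πt/Δ + 2)`
    push Not at hcase
    have hx0 : 0 < Real.pi * t / Δ U := by positivity
    obtain ⟨L', hL'pos, hL'even, hL'ge, hL'lt⟩ := exists_even_side (Real.pi * t / Δ U) hx0
    haveI : NeZero L' := ⟨hL'pos.ne'⟩
    have hL'r : (0 : ℝ) < (L' : ℝ) := Nat.cast_pos.2 hL'pos
    have h2x : 2 * (Real.pi * t / Δ U) = 2 * Real.pi * t / Δ U := by ring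
    rw [h2x] at hL'ge hL'lt
    -- `2πt ≤ Δ L' ≤ 2πt + 2`
    have hΔL'ge : 2 * Real.pi * t ≤ Δ U * L' := by
      have h := (div_le_iff₀ hΔpos).1 hL'ge
      linarith [mul_comm (L' : ℝ) (Δ U)]
    have hΔL'le : Δ U * L' ≤ 2 * Real.pi * t + 2 := by
      have h := mul_lt_mul_of_pos_left hL'lt hΔpos
      have hkey : Δ U * (2 * Real.pi * t / Δ U + 2) = 2 * Real.pi * t + 2 * Δ U := by
        field_simp
      rw [hkey] at h
      nlinarith
    -- `L' ≤ L`
    have hL'leL : L' ≤ L := by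
      have h2 : (2 : ℝ) ≤ 2 / Δ U := by
        rw [le_div_iff₀ hΔpos]
        nlinarith
      have h3 : (2 * Real.pi * t + 2) / Δ U < L := by
        rw [div_lt_iff₀ hΔpos]
        linarith [mul_comm (L : ℝ) (Δ U)]
      have h4 : (2 * Real.pi * t + 2) / Δ U = 2 * Real.pi * t / Δ U + 2 / Δ U := by
        rw [add_div]
      have h1 : (L' : ℝ) < (L : ℝ) := by linarith
      exact_mod_cast h1.le
    -- `L₀ ≤ L'`
    have hL₀L' : L₀ ≤ (L' : ℝ) := by
      have h1 : 2 * Real.pi * t ≤ 2 * Real.pi * t / Δ U := by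
        rw [le_div_iff₀ hΔpos]
        have h0 : 0 ≤ 2 * Real.pi * t := by positivity
        exact mul_le_of_le_one_right h0 hΔle
      linarith
    -- order on the octave `[L'/2, L']` from W
    have hθ : ∀ (L'' : ℕ) [NeZero L''], Even L'' → (L' : ℝ) ≤ 2 * L'' → L'' ≤ L' →
        ∀ ψ'' : Fock (Orb (FermionTorus 2 L'')), star ψ'' ⬝ᵥ ψ'' = 1 →
          IsGroundStateInSector (hubbardTorus 2 L'' 1 U) (2 * ⌊(1 - δ) * (L'' : ℝ) ^ 2 / 2⌋₊) 0 ψ'' →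
            c₀ * Δ U ^ 2 * (L'' : ℝ) ^ 2 ≤ pairStructureFactor dWaveFormFactor L'' ψ'' 0 := by
      intro L'' _ hL''even hL''ge hL''le ψ'' hψ'' hGS''
      have hL''r : (0 : ℝ) < (L'' : ℝ) := Nat.cast_pos.2 (Nat.pos_of_ne_zero (NeZero.ne L''))
      have hle : (L'' : ℝ) ≤ (L' : ℝ) := by exact_mod_cast hL''le
      have hlo : s₀ ≤ Δ U * L'' := by
        have h1 : Δ U * L' ≤ 2 * (Δ U * L'') := by nlinarith
        linarith
      have hhi : Δ U * L'' ≤ 2 * Real.pi * t + 2 := by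
        have h1 : Δ U * L'' ≤ Δ U * L' := by nlinarith
        linarith
      have hord := hWs δ hδ U hUU₁ L'' hL''even hlo hhi ψ'' hψ'' hGS''
      have hL''2 : (0 : ℝ) < (L'' : ℝ) ^ 2 := by positivity
      have hL''4 : (0 : ℝ) < (L'' : ℝ) ^ 4 := by positivity
      rw [le_div_iff₀ hL''4] at hord
      rw [pairStructureFactor_zero dWaveFormFactor L'' ψ'', le_div_iff₀ hL''2]
      calc c₀ * Δ U ^ 2 * (L'' : ℝ) ^ 2 * (L'' : ℝ) ^ 2 = c₀ * Δ U ^ 2 * (L'' : ℝ) ^ 4 := by ring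
        _ ≤ _ := hord
    have hmain :=
      hVM U δ (c₀ * Δ U ^ 2) L' L hU0 hUst hδ hL'even hL hL₀L' hL'leL hθ ψ hψ hGS
    -- the radius `2π/L'` window sits inside the radius `Δ(U)/t` window
    have hrad : (2 * Real.pi / (L' : ℝ)) ^ 2 ≤ (Δ U / t) ^ 2 := by
      have h1 : 2 * Real.pi / (L' : ℝ) ≤ Δ U / t := by
        rw [div_le_div_iff₀ hL'r ht0]
        linarith
      have h0 : 0 ≤ 2 * Real.pi / (L' : ℝ) := by positivity
      exact pow_le_pow_left₀ h0 h1 2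
    have hsub : Finset.univ.filter
          (fun m : Fin 2 → ZMod L => momentumNormSq L m ≤ (2 * Real.pi / (L' : ℝ)) ^ 2) ⊆
        Finset.univ.filter (fun m : Fin 2 → ZMod L => momentumNormSq L m ≤ (Δ U / t) ^ 2) := by
      intro m hm
      simp only [Finset.mem_filter, Finset.mem_univ, true_and] at hm ⊢
      exact le_trans hm hrad
    have hmono := Finset.sum_le_sum_of_subset_of_nonneg hsub
      (fun m _ _ => pairStructureFactor_nonneg dWaveFormFactor L ψ m)
    calc min 1 C * c₀ * Δ U ^ 2 * (L : ℝ) ^ 2 = min 1 C * (c₀ * Δ U ^ 2 * (L : ℝ) ^ 2) := by ring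
      _ ≤ C * (c₀ * Δ U ^ 2 * (L : ℝ) ^ 2) := mul_le_mul_of_nonneg_right hminC hnn
      _ = C * (c₀ * Δ U ^ 2) * (L : ℝ) ^ 2 := by ring
      _ ≤ _ := hmain
      _ ≤ _ := hmono

end Summit.HubbardSuperconductivity.HubbardSuperconductivity.Theorems.InfraredCompletion

end
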